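import Literature.AnabelianGeometry.SemiGraphs.QDPairHomHatTransport
import Literature.AnabelianGeometry.SemiGraphs.BTempQDPairCoversDirected
import HarnessLib

/-!
# Semi-graphs of anabelioids, Appendix, proof of Theorem A.4: the strongly connected QD-pairs
# `(B′, Γ_B′)` attached to the connected components of a QD-pair of `B^temp(Π)`, the isomorphism
# `q(B′, Γ_B′) ⥲ q(B, Γ_B)` for `(B, Γ_B)` weakly connected, and the isomorphisms
# `(B′, Γ_B′) ⥲ (B″, Γ_B″)` induced by `γ_B ∈ Γ_B` with `γ_B(B′) = B″`

Mochizuki, *Semi-graphs of anabelioids*, Publ. RIMS **42** (2006) 221–322, Appendix, proof of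
Theorem A.4, manuscript p. 84 (PRIMS p. 314 ll. 9–18) [cite: MochizukiSemiAnbd2006, Thm A.4 proof p.84]:
"Next, suppose that `(B, Γ_B)`, `(C, Γ_C)` are weakly connected QD-pairs. Then observe that each
connected component `B′` of `B` determines a strongly connected QD-pair `(B′, Γ_B′)` [i.e., where we
take `Γ_B′ ⊆ Γ_B` to be the subgroup of automorphisms that fix the element `[B′] ∈ π₀(B)` determined
by `B′`] such that `q_i((B′, Γ_B′)) ≅ q_i((B, Γ_B))` … if `B′, B″` … are connected components of `B`
… any choice of elements `γ_B ∈ Γ_B` … such that `γ_B(B′) = B″` … determines a bijection …".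

Row **A4-lim-wc** of `plan/L3/SUBDAG-SemiAnbd-Cor311.md` (holder abc-iut-w5-d129), PART (wc-1) — seat
abc-iut-w4-d048 under the split with abc-iut-w4-d089 (whose `QDPairHomHatTransport.lean` is the
category-general transport part (wc-2): `QDPair.autOfMem`, `QDPair.HomHat.map`, …) — for the model
temperoid `T = B^temp(Π)`, where the connected components of `B` are the `Π`-orbits
(`BTemp.orbitObj`, `BTemp.isComponent_orbitIncl`):

* `QDPair.componentGroup P b`, **`QDPair.componentPair P b`** `= (B′, Γ_B′)` for `B′ = Π · b`, with
  `Γ_B′ :=` the restrictions to `B′` of the elements of `Γ_B` stabilising `[B′]`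
  (`BTemp.stabOrbit`/`restrictOrbit`, `BTempPullbackOrbit.lean`); it is strongly connected;
  **`QDPair.componentIncl P b : (B′, Γ_B′) → (B, Γ_B)`** (the inclusion is a morphism of QD-pairs);
* `QDPair.exists_aut_apply_eq_of_isWeaklyConnected` (weak connectedness on points: `Γ_B` moves some
  point of every component to any given point) and **`QDPair.isIso_orbitQuotientMap_componentIncl`**:
  for `(B, Γ_B)` weakly connected, `q(B′, Γ_B′) → q(B, Γ_B)` is an ISOMORPHISM
  ("`q_i((B′, Γ_B′)) ≅ q_i((B, Γ_B))`"); `Π` any topological group;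
* for `γ ∈ Γ_B` with `γ(B′) = B″` (`γ b` in the orbit of `b′`): the morphism / isomorphism of QD-pairs
  `QDPair.componentHom`, **`QDPair.componentIso : (B′, Γ_B′) ≅ (B″, Γ_B″)`** it induces, the square
  `componentHom ≫ componentIncl b′ = componentIncl b ≫ γ` (`componentHom_comp_incl`) and, after `q`,
  `q(componentHom) ≫ q(incl_{B″}) = q(incl_{B′})` (`q(γ) = 𝟙`, `orbitQuotientMap_autOfMem`) — so under
  the identifications `q(B′, Γ_B′) ≅ q(B, Γ_B) ≅ q(B″, Γ_B″)` the isomorphism induced by `γ` is the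
  identity, whatever `γ` was chosen;
* `QDPair.homHatToHom_map`: the comparison map `Hom^ → Hom_T` intertwines abc-iut-w4-d089's transport
  `HomHat.map e g` with `q(e)⁻¹ ≫ (−) ≫ q(g)`.

Part (wc-3) (`BTempQDPairHomHatWC.lean`) assembles `Hom^` of weakly connected pairs as matching
families.  Elementary `Π`-set theory; nothing refers to the IUT corpus; no side is taken on any
disputed claim.
-/

open CategoryTheory

namespace Literature.AnabelianGeometry.SemiGraphs

open Literature.AlgebraicGeometry.Frobenioids (IsConnectedObj)
open Literature.AlgebraicGeometry.Frobenioids.QuasiTemperoid.BTempConnected (hom_ρ hom_ext_apply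
  ρ_one_apply ρ_mul_apply ρ_inv_apply isIso_of_bijective)

universe u

namespace QDPair

variable {G : Type u} [Group G] [TopologicalSpace G]

/-! ### Pointwise bookkeeping for automorphisms of an object of `B^temp(Π)` -/

section Pointwise

variable {X : BTemp G}

/-- `(γ * δ)(x) = γ(δ(x))`. [folklore] -/
private theorem aut_mul_apply (γ δ : Aut X) (x : X.obj.V) :
    ((γ * δ).hom.hom.hom x : X.obj.V) = γ.hom.hom.hom (δ.hom.hom.hom x) := rfl

/-- `γ⁻¹(γ(x)) = x`. [folklore] -/
private theorem aut_inv_apply_self (γ : Aut X) (x : X.obj.V) :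
    ((γ⁻¹).hom.hom.hom (γ.hom.hom.hom x) : X.obj.V) = x := by
  change ((γ.hom ≫ γ.inv).hom.hom x : X.obj.V) = x
  rw [γ.hom_inv_id]
  rfl

/-- `γ(γ⁻¹(x)) = x`. [folklore] -/
private theorem aut_apply_inv_self (γ : Aut X) (x : X.obj.V) :
    (γ.hom.hom.hom ((γ⁻¹).hom.hom.hom x) : X.obj.V) = x := by
  change ((γ.inv ≫ γ.hom).hom.hom x : X.obj.V) = x
  rw [γ.inv_hom_id]
  rfl

end Pointwise

/-! ### The strongly connected QD-pair `(B′, Γ_B′)` of a connected component `B′ = Π · b` -/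

section Component

variable (P : QDPair (BTemp G)) (b : P.A.obj.V)

/-- **`Γ_B′`**: "the subgroup [of `Γ_B`] of automorphisms that fix the element `[B′] ∈ π₀(B)`
determined by `B′`", acting on `B′ = Π · b` by restriction — the image under
`BTemp.restrictOrbit` of `Γ_B ∩ Stab([B′])`. [cite: MochizukiSemiAnbd2006, Thm A.4 proof p.84] -/
def componentGroup : Subgroup (Aut (BTemp.orbitObj P.A b)) :=
  (P.Γ.subgroupOf (BTemp.stabOrbit P.A b)).map (BTemp.restrictOrbit P.A b)

/-- Membership in `Γ_B′`: restrictions of orbit-stabilising elements of `Γ_B`.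
[cite: MochizukiSemiAnbd2006, Thm A.4 proof p.84] -/
theorem mem_componentGroup_iff (ε : Aut (BTemp.orbitObj P.A b)) :
    ε ∈ P.componentGroup b ↔
      ∃ σ : BTemp.stabOrbit P.A b, σ.1 ∈ P.Γ ∧ BTemp.restrictOrbit P.A b σ = ε := by
  constructor
  · rintro ⟨σ, hσ, rfl⟩
    exact ⟨σ, Subgroup.mem_subgroupOf.mp hσ, rfl⟩
  · rintro ⟨σ, hσ, rfl⟩
    exact ⟨σ, Subgroup.mem_subgroupOf.mpr hσ, rfl⟩

/-- The restriction of an orbit-stabilising `γ ∈ Γ_B` lies in `Γ_B′`. [cite: MochizukiSemiAnbd2006, Thm A.4 proof p.84] -/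
theorem restrictOrbit_mem_componentGroup (σ : BTemp.stabOrbit P.A b) (hσ : σ.1 ∈ P.Γ) :
    BTemp.restrictOrbit P.A b σ ∈ P.componentGroup b :=
  (P.mem_componentGroup_iff b _).mpr ⟨σ, hσ, rfl⟩

/-- **The QD-pair `(B′, Γ_B′)` of the connected component `B′ = Π · b` of `B`** ("each connected
component `B′` of `B` determines a strongly connected QD-pair `(B′, Γ_B′)`").
[cite: MochizukiSemiAnbd2006, Thm A.4 proof p.84] -/
def componentPair : QDPair (BTemp G) := ⟨BTemp.orbitObj P.A b, P.componentGroup b⟩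

/-- `(B′, Γ_B′)` is strongly connected (`B′` is a single `Π`-orbit). [cite: MochizukiSemiAnbd2006, Thm A.4 proof p.84] -/
theorem componentPair_isStronglyConnected : (P.componentPair b).IsStronglyConnected :=
  BTemp.orbitObj_isConnectedObj P.A b

/-- **The inclusion `(B′, Γ_B′) → (B, Γ_B)` is a morphism of QD-pairs** (a restricted `γ` lies over
`γ`). [cite: MochizukiSemiAnbd2006, Thm A.4 proof p.84] -/
def componentIncl : P.componentPair b ⟶ P where
  hom := BTemp.orbitIncl P.A b
  comm := by
    intro ε hε
    obtain ⟨σ, hσ, rfl⟩ := (P.mem_componentGroup_iff b ε).mp hε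
    exact ⟨σ.1, hσ, (BTemp.restrictOrbit_incl P.A b σ).symm⟩

/-- The inclusion on points. [cite: MochizukiSemiAnbd2006, Thm A.4 proof p.84] -/
@[simp] theorem componentIncl_apply (y : (BTemp.orbitObj P.A b).obj.V) :
    ((P.componentIncl b).hom.hom.hom y : P.A.obj.V) = y.1 := rfl

/-- An automorphism of `B` that maps one point of `B′` into `B′` stabilises `[B′]`.
[cite: MochizukiSemiAnbd2006, Thm A.4 proof p.84] -/
theorem mem_stabOrbit_of_apply_eq {γ : Aut P.A} (y y' : (BTemp.orbitObj P.A b).obj.V)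
    (h : (γ.hom.hom.hom y.1 : P.A.obj.V) = y'.1) : γ ∈ BTemp.stabOrbit P.A b := by
  obtain ⟨a, ha⟩ := y.2
  obtain ⟨a', ha'⟩ := y'.2
  refine ⟨a⁻¹ * a', ?_⟩
  rw [ρ_mul_apply, ha', ← h, ← hom_ρ, ← ha, ρ_inv_apply]

/-! ### Weak connectedness on points; `q(B′, Γ_B′) ⥲ q(B, Γ_B)` -/

/-- **Weak connectedness read on points**: if `Γ_B` acts transitively on `π₀(B)`, then for every
point `x ∈ B` some `γ ∈ Γ_B` carries a point of `B′ = Π · b` to `x` (the components of `B` are the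
`Π`-orbits, `BTemp.isComponent_orbitIncl`). [cite: MochizukiSemiAnbd2006, Thm A.4 proof p.84] -/
theorem exists_aut_apply_eq_of_isWeaklyConnected (hP : P.IsWeaklyConnected) (x : P.A.obj.V) :
    ∃ γ ∈ P.Γ, ∃ y : (BTemp.orbitObj P.A b).obj.V, (γ.hom.hom.hom y.1 : P.A.obj.V) = x := by
  obtain ⟨γ, hγ, e, he⟩ := hP.2 _ _ (BTemp.isComponent_orbitIncl P.A b)
    (BTemp.isComponent_orbitIncl P.A x)
  refine ⟨γ, hγ, e.inv.hom.hom (BTemp.orbitPt P.A x), ?_⟩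
  have h1 := congrArg
    (fun φ => ((φ.hom.hom (e.inv.hom.hom (BTemp.orbitPt P.A x)) : P.A.obj.V))) he
  have h2 : (e.hom.hom.hom (e.inv.hom.hom (BTemp.orbitPt P.A x)) : (BTemp.orbitObj P.A x).obj.V) =
      BTemp.orbitPt P.A x := by
    change ((e.inv ≫ e.hom).hom.hom (BTemp.orbitPt P.A x) : (BTemp.orbitObj P.A x).obj.V) = _
    rw [e.inv_hom_id]
    rfl
  change (γ.hom.hom.hom (e.inv.hom.hom (BTemp.orbitPt P.A x)).1 : P.A.obj.V) =
    (e.hom.hom.hom (e.inv.hom.hom (BTemp.orbitPt P.A x))).1 at h1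
  rw [h2] at h1
  exact h1

variable [IsTopologicalGroup G]

/-- **"`q_i((B′, Γ_B′)) ≅ q_i((B, Γ_B))`"**: for `(B, Γ_B)` weakly connected, the arrow
`B′/Γ_B′ → B/Γ_B` induced by the inclusion is an ISOMORPHISM of `B^temp(Π)` — injective because an
element of `Γ_B` identifying two points of `B′` stabilises `[B′]`, hence restricts to `Γ_B′`;
surjective by weak connectedness. (`Π` any topological group.)
[cite: MochizukiSemiAnbd2006, Thm A.4 proof p.84] -/
theorem isIso_orbitQuotientMap_componentIncl (hP : P.IsWeaklyConnected) :
    IsIso (orbitQuotientMap (P.componentIncl b)) := by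
  apply isIso_of_bijective
  constructor
  · intro q q'
    induction q using Quotient.ind with
    | _ y =>
      induction q' using Quotient.ind with
      | _ y' =>
        intro hq
        change P.orbitMk y.1 = P.orbitMk y'.1 at hq
        obtain ⟨γ, hγ, hγy⟩ := P.orbitMk_eq_iff.mp hq
        have hst : γ ∈ BTemp.stabOrbit P.A b := P.mem_stabOrbit_of_apply_eq b y y' hγy
        exact (P.componentPair b).orbitMk_eq_iff.mpr ⟨BTemp.restrictOrbit P.A b ⟨γ, hst⟩,
          P.restrictOrbit_mem_componentGroup b ⟨γ, hst⟩ hγ, Subtype.ext hγy⟩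
  · intro q
    induction q using Quotient.ind with
    | _ x =>
      obtain ⟨γ, hγ, y, hy⟩ := P.exists_aut_apply_eq_of_isWeaklyConnected b hP x
      exact ⟨(P.componentPair b).orbitMk y, P.orbitMk_eq_iff.mpr ⟨γ, hγ, hy⟩⟩

/-- The isomorphism `q(B′, Γ_B′) ⥲ q(B, Γ_B)` as an `Iso`. [cite: MochizukiSemiAnbd2006, Thm A.4 proof p.84] -/
noncomputable def componentQuotientIso (hP : P.IsWeaklyConnected) :
    (P.componentPair b).orbitQuotient ≅ P.orbitQuotient :=
  haveI := P.isIso_orbitQuotientMap_componentIncl b hP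
  asIso (orbitQuotientMap (P.componentIncl b))

/-- `componentQuotientIso` is `q(incl)`. [cite: MochizukiSemiAnbd2006, Thm A.4 proof p.84] -/
@[simp] theorem componentQuotientIso_hom (hP : P.IsWeaklyConnected) :
    (P.componentQuotientIso b hP).hom = orbitQuotientMap (P.componentIncl b) := rfl

end Component

/-! ### The isomorphism `(B′, Γ_B′) ⥲ (B″, Γ_B″)` induced by `γ_B ∈ Γ_B` with `γ_B(B′) = B″` -/

section Move

variable {P : QDPair (BTemp G)} {b b' : P.A.obj.V}

/-- If `γ b ∈ Π · b′` then `γ` maps all of `B′ = Π · b` into `B″ = Π · b′`.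
[cite: MochizukiSemiAnbd2006, Thm A.4 proof p.84] -/
theorem exists_ρ_eq_aut_apply (γ : Aut P.A) (h : ∃ a : G, P.A.obj.ρ a b' = γ.hom.hom.hom b) (y : (BTemp.orbitObj P.A b).obj.V) :
    ∃ a : G, P.A.obj.ρ a b' = γ.hom.hom.hom y.1 := by
  obtain ⟨a, ha⟩ := h
  obtain ⟨c, hc⟩ := y.2
  exact ⟨c * a, by rw [ρ_mul_apply, ha, ← hom_ρ, hc]⟩

/-- If `γ b ∈ Π · b′` then `γ⁻¹ b′ ∈ Π · b` (`γ⁻¹(B″) = B′`). [cite: MochizukiSemiAnbd2006, Thm A.4 proof p.84] -/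
theorem exists_ρ_eq_inv_apply (γ : Aut P.A) (h : ∃ a : G, P.A.obj.ρ a b' = γ.hom.hom.hom b) :
    ∃ a : G, P.A.obj.ρ a b = (γ⁻¹).hom.hom.hom b' := by
  obtain ⟨a, ha⟩ := h
  refine ⟨a⁻¹, ?_⟩
  have h1 : ((γ⁻¹).hom.hom.hom (P.A.obj.ρ a b') : P.A.obj.V) = b := by
    rw [ha]
    exact aut_inv_apply_self γ b
  rw [hom_ρ] at h1
  have h2 := congrArg (P.A.obj.ρ a⁻¹) h1
  rw [ρ_inv_apply] at h2
  exact h2.symm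

/-- Conjugation by `γ` carries `Stab([B′])` into `Stab([B″])`. [cite: MochizukiSemiAnbd2006, Thm A.4 proof p.84] -/
theorem conj_mem_stabOrbit (γ : Aut P.A) (h : ∃ a : G, P.A.obj.ρ a b' = γ.hom.hom.hom b) {σ : Aut P.A}
    (hσ : σ ∈ BTemp.stabOrbit P.A b) : γ * σ * γ⁻¹ ∈ BTemp.stabOrbit P.A b' := by
  obtain ⟨a₁, ha₁⟩ := exists_ρ_eq_inv_apply γ h
  obtain ⟨s, hs⟩ := hσ
  obtain ⟨a, ha⟩ := h
  refine ⟨a₁ * s * a, ?_⟩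
  change P.A.obj.ρ (a₁ * s * a) b' = γ.hom.hom.hom (σ.hom.hom.hom ((γ⁻¹).hom.hom.hom b'))
  rw [ρ_mul_apply, ρ_mul_apply, ha, ← ha₁, hom_ρ σ.hom, ← hs, hom_ρ γ.hom, hom_ρ γ.hom]

/-- **The arrow `B′ → B″` of `B^temp(Π)` obtained by restricting `γ`** (`γ(B′) = B″`).
[cite: MochizukiSemiAnbd2006, Thm A.4 proof p.84] -/
def componentArrow (γ : Aut P.A) (h : ∃ a : G, P.A.obj.ρ a b' = γ.hom.hom.hom b) :
    BTemp.orbitObj P.A b ⟶ BTemp.orbitObj P.A b' :=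
  ObjectProperty.homMk
    { hom := TypeCat.ofHom fun y => ⟨γ.hom.hom.hom y.1, exists_ρ_eq_aut_apply γ h y⟩
      comm := fun g => by
        refine ConcreteCategory.hom_ext _ _ fun y => Subtype.ext ?_
        exact hom_ρ γ.hom g y.1 }

/-- The restricted arrow on points. [cite: MochizukiSemiAnbd2006, Thm A.4 proof p.84] -/
@[simp] theorem componentArrow_apply_val (γ : Aut P.A) (h : ∃ a : G, P.A.obj.ρ a b' = γ.hom.hom.hom b)
    (y : (BTemp.orbitObj P.A b).obj.V) :
    (((componentArrow γ h).hom.hom y : (BTemp.orbitObj P.A b').obj.V)).1 = γ.hom.hom.hom y.1 := rfl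

/-- **The morphism of QD-pairs `(B′, Γ_B′) → (B″, Γ_B″)` induced by `γ ∈ Γ_B` with `γ(B′) = B″`**:
a restricted `σ ∈ Γ_B ∩ Stab([B′])` descends to the restriction of `γ σ γ⁻¹ ∈ Γ_B ∩ Stab([B″])`.
[cite: MochizukiSemiAnbd2006, Thm A.4 proof p.84] -/
def componentHom (γ : Aut P.A) (h : ∃ a : G, P.A.obj.ρ a b' = γ.hom.hom.hom b) (hγ : γ ∈ P.Γ) :
    P.componentPair b ⟶ P.componentPair b' where
  hom := componentArrow γ h
  comm := by
    intro ε hε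
    obtain ⟨σ, hσ, rfl⟩ := (P.mem_componentGroup_iff b ε).mp hε
    have hσ' : γ * σ.1 * γ⁻¹ ∈ BTemp.stabOrbit P.A b' := conj_mem_stabOrbit γ h σ.2
    refine ⟨BTemp.restrictOrbit P.A b' ⟨γ * σ.1 * γ⁻¹, hσ'⟩,
      P.restrictOrbit_mem_componentGroup b' ⟨γ * σ.1 * γ⁻¹, hσ'⟩
        (P.Γ.mul_mem (P.Γ.mul_mem hγ hσ) (P.Γ.inv_mem hγ)), ?_⟩
    exact hom_ext_apply fun y => Subtype.ext (by
      change ((γ * σ.1 * γ⁻¹).hom.hom.hom (γ.hom.hom.hom y.1) : P.A.obj.V) =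
        γ.hom.hom.hom (σ.1.hom.hom.hom y.1)
      rw [aut_mul_apply, aut_mul_apply, aut_inv_apply_self])

/-- `componentHom` on underlying arrows. [cite: MochizukiSemiAnbd2006, Thm A.4 proof p.84] -/
@[simp] theorem componentHom_hom (γ : Aut P.A) (h : ∃ a : G, P.A.obj.ρ a b' = γ.hom.hom.hom b) (hγ : γ ∈ P.Γ) :
    (componentHom γ h hγ).hom = componentArrow γ h := rfl

/-- **The square `(B′, Γ_B′) → (B″, Γ_B″) → (B, Γ_B)` = `(B′, Γ_B′) → (B, Γ_B) →γ (B, Γ_B)`**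
(`γ` acting on `(B, Γ_B)` as the automorphism `autOfMem`). [cite: MochizukiSemiAnbd2006, Thm A.4 proof p.84] -/
theorem componentHom_comp_incl (γ : Aut P.A) (h : ∃ a : G, P.A.obj.ρ a b' = γ.hom.hom.hom b) (hγ : γ ∈ P.Γ) :
    componentHom γ h hγ ≫ P.componentIncl b' = P.componentIncl b ≫ (autOfMem P γ hγ).hom :=
  Hom.ext (hom_ext_apply fun _ => rfl)

/-- **The isomorphism of QD-pairs `(B′, Γ_B′) ⥲ (B″, Γ_B″)` induced by `γ ∈ Γ_B` with
`γ(B′) = B″`** (inverse induced by `γ⁻¹`). [cite: MochizukiSemiAnbd2006, Thm A.4 proof p.84] -/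
def componentIso (γ : Aut P.A) (h : ∃ a : G, P.A.obj.ρ a b' = γ.hom.hom.hom b) (hγ : γ ∈ P.Γ) :
    P.componentPair b ≅ P.componentPair b' where
  hom := componentHom γ h hγ
  inv := componentHom γ⁻¹ (exists_ρ_eq_inv_apply γ h) (P.Γ.inv_mem hγ)
  hom_inv_id := Hom.ext (hom_ext_apply fun y => Subtype.ext (aut_inv_apply_self γ y.1))
  inv_hom_id := Hom.ext (hom_ext_apply fun y => Subtype.ext (aut_apply_inv_self γ y.1))

/-- `componentIso` on `hom`. [cite: MochizukiSemiAnbd2006, Thm A.4 proof p.84] -/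
@[simp] theorem componentIso_hom (γ : Aut P.A) (h : ∃ a : G, P.A.obj.ρ a b' = γ.hom.hom.hom b) (hγ : γ ∈ P.Γ) :
    (componentIso γ h hγ).hom = componentHom γ h hγ := rfl

end Move

/-! ### After `q`: the isomorphisms induced by `γ_B` are the identity on `q(B, Γ_B)` -/

section Quotients

variable [IsTopologicalGroup G]

/-- **`q(γ) = 𝟙_{B/Γ_B}` for `γ ∈ Γ_B`** (as the automorphism `autOfMem` of the QD-pair).
[cite: MochizukiSemiAnbd2006, Thm A.4 proof p.84] -/
@[simp] theorem orbitQuotientMap_autOfMem (P : QDPair (BTemp G)) (γ : Aut P.A) (hγ : γ ∈ P.Γ) :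
    orbitQuotientMap (autOfMem P γ hγ).hom = 𝟙 P.orbitQuotient := by
  apply P.orbitQuotient_hom_ext
  rw [orbitQuotientπ_map, Category.comp_id]
  exact P.aut_comp_orbitQuotientπ hγ

/-- `q` of an isomorphism of QD-pairs is an isomorphism. [cite: MochizukiSemiAnbd2006, Thm A.4 proof p.84] -/
theorem isIso_orbitQuotientMap_iso {P P' : QDPair (BTemp G)} (e : P ≅ P') :
    IsIso (orbitQuotientMap e.hom) :=
  (orbitQuotientFunctor (G := G)).map_isIso e.hom

variable {P : QDPair (BTemp G)} {b b' : P.A.obj.V}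

/-- **`q(B′ → B″) ≫ q(B″ → B) = q(B′ → B)`**: after `q`, the isomorphism induced by `γ` is compatible
with the identifications `q(B′, Γ_B′) ≅ q(B, Γ_B) ≅ q(B″, Γ_B″)` — WHATEVER `γ` was chosen (this is
"independent of the choice of `γ_B`" at the level of `T`). [cite: MochizukiSemiAnbd2006, Thm A.4 proof p.84] -/
theorem orbitQuotientMap_componentHom_comp (γ : Aut P.A) (h : ∃ a : G, P.A.obj.ρ a b' = γ.hom.hom.hom b) (hγ : γ ∈ P.Γ) :
    orbitQuotientMap (componentHom γ h hγ) ≫ orbitQuotientMap (P.componentIncl b') =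
      orbitQuotientMap (P.componentIncl b) := by
  have h1 : orbitQuotientMap (componentHom γ h hγ ≫ P.componentIncl b') =
      orbitQuotientMap (componentHom γ h hγ) ≫ orbitQuotientMap (P.componentIncl b') :=
    (orbitQuotientFunctor (G := G)).map_comp _ _
  have h2 : orbitQuotientMap (P.componentIncl b ≫ (autOfMem P γ hγ).hom) =
      orbitQuotientMap (P.componentIncl b) ≫ orbitQuotientMap (autOfMem P γ hγ).hom :=
    (orbitQuotientFunctor (G := G)).map_comp _ _
  rw [← h1, componentHom_comp_incl, h2, orbitQuotientMap_autOfMem, Category.comp_id]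

/-- The same with the isomorphisms `q(B′, Γ_B′) ⥲ q(B, Γ_B)` of weakly connected `(B, Γ_B)`:
`q(componentIso γ) = q(incl_{B′}) ≫ q(incl_{B″})⁻¹`. [cite: MochizukiSemiAnbd2006, Thm A.4 proof p.84] -/
theorem orbitQuotientMap_componentIso_hom (γ : Aut P.A) (h : ∃ a : G, P.A.obj.ρ a b' = γ.hom.hom.hom b) (hγ : γ ∈ P.Γ)
    (hP : P.IsWeaklyConnected) :
    orbitQuotientMap (componentIso γ h hγ).hom =
      (P.componentQuotientIso b hP).hom ≫ (P.componentQuotientIso b' hP).inv := by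
  rw [Iso.eq_comp_inv]
  exact orbitQuotientMap_componentHom_comp γ h hγ

/-! ### `Hom^ → Hom_T` and the transport of abc-iut-w4-d089 -/

/-- **The comparison map `Hom^ → Hom_T` intertwines `HomHat.map e g` with `q(e)⁻¹ ≫ (−) ≫ q(g)`**:
`homHatToHom (HomHat.map e g x) = q(e)⁻¹ ≫ homHatToHom x ≫ q(g)` for an isomorphism `e` of sources
and a morphism `g` of targets. [cite: MochizukiSemiAnbd2006, Thm A.4 proof p.84] -/
theorem homHatToHom_map {P P' C C' : QDPair (BTemp G)} (e : P ≅ P') (g : C ⟶ C') (x : HomHat P C) :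
    haveI := isIso_orbitQuotientMap_iso e
    homHatToHom P' C' (HomHat.map e g x) =
      inv (orbitQuotientMap e.hom) ≫ homHatToHom P C x ≫ orbitQuotientMap g := by
  haveI := isIso_orbitQuotientMap_iso e
  obtain ⟨⟨c, y⟩, rfl⟩ := homHatMk_surjective x
  haveI := isIso_orbitQuotientMap_of_isOneProper c.hom c.isOneProper
  haveI := isIso_orbitQuotientMap_of_isOneProper (c.transport e).hom (c.transport e).isOneProper
  induction y using Quotient.ind with
  | _ f =>
    change (c.transport e).toHom (homBarMk (f ≫ g)) =
      inv (orbitQuotientMap e.hom) ≫ c.toHom (homBarMk f) ≫ orbitQuotientMap g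
    rw [OneProperCover.toHom_mk, OneProperCover.toHom_mk]
    have hf : orbitQuotientMap ((f : (c.transport e).src ⟶ C) ≫ g) =
        orbitQuotientMap f ≫ orbitQuotientMap g :=
      (orbitQuotientFunctor (G := G)).map_comp f g
    have hc : orbitQuotientMap (c.transport e).hom = orbitQuotientMap c.hom ≫ orbitQuotientMap e.hom :=
      (orbitQuotientFunctor (G := G)).map_comp c.hom e.hom
    rw [hf, ← Category.assoc, ← Category.assoc]
    congr 1
    rw [IsIso.inv_comp_eq, hc]
    simp only [Category.assoc, IsIso.hom_inv_id_assoc]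

end Quotients

end QDPair

end Literature.AnabelianGeometry.SemiGraphs
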